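import Literature.Computability.AlgebraicComplexity.FSV18JacobianCriterionCharZero
import Literature.RingTheory.Nullstellensatz.PerronSharpDegreeBound

/-!
# FSV 2018 Fact 51 (the Jacobian criterion [BMS13]) in positive characteristic

M. Beecken, J. Mittmann, N. Saxena, *Algebraic independence and blackbox identity testing*, Inform.
and Comput. 222 (2013) (= arXiv:1102.2789), **Thm. 6 (Jacobian criterion):** «Let
`f_1, …, f_m ∈ K[x]` be polynomials of degree at most `δ` and trdeg `r`. Assume that `ch(K) = 0`
or `ch(K) > δ^r`. Then `rk_L J_x(f_1, …, f_m) = trdeg_K{f_1, …, f_m}`, where `L = K(x)`» — quoted by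
M. A. Forbes, A. Shpilka, B. L. Volk (ToC 14 (2018)) as **Fact 51** (= ToC Fact 6.2), the named
fact `ForbesShpilkaVolk2018_fact51` (`FSV2018ROABP`).  `≤` holds in every characteristic
(`jacobianRank_le_of_trdegLE`, `FSV18Lemma53Reduction`); `≥` is PROVED in characteristic `0` in
`FSV18JacobianCriterionCharZero`.  This file follows the PRINTED proof of `≥` in [BMS13, App. A]
(arXiv p. 14): «we may assume that `f_1, …, f_r, x_{r+1}, …, x_n` are algebraically independent.
Consequently, for `i = 1, …, n`, there exist non-zero polynomials `F_i ∈ K[y_0, …, y_n]` of minimal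
degree such that `deg_{y_0}(F_i) > 0` and `F_i(x_i, f_1, …, f_r, x_{r+1}, …, x_n) = 0`.  By
Theorem 4 [Perron] (with `(n−r+1)` of the `δ_i`'s being `1`), we have `deg(F_i) ≤ δ^r`.  Hence, by
the assumptions on `ch(K)`, we have `∂_{y_0} F_i ≠ 0`.  Since the degree of `F_i` was chosen to be
minimal, `(∂_{y_0} F_i)(…) ≠ 0` … Differentiating … the block diagonal matrix … is invertible.»

Structure (theorems only; no definitions, no new facts):
* `notMem_vars_of_pderiv_eq_zero_of_cast_ne_zero` — «by the assumptions on `ch(K)`,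
  `∂_{y_0}F_i ≠ 0`», characteristic-free;
* `det_jacobianMatrix_ne_zero_of_algebraicIndependent_of_degreeBound` — the square step
  (Humphreys § 3.10 «⟹» = the tree's `det_jacobianMatrix_ne_zero_of_algebraicIndependent`, re-run
  with an abstract bound `B` on the degree of the relations in place of characteristic `0`);
* the degree bound `B` supplied two ways: by the tree's PROVED weak Perron theorem
  (`Literature.RingTheory.Nullstellensatz.exists_algRelation_of_totalDegree_le`,
  `B = (n+1)(2δ(n+1))^n`) — giving an UNCONDITIONAL Jacobian criterion in large characteristic with
  a worse constant than print — and by the SHARP Perron theorem [BMS13 Thm. 4 = Płoski 2005], the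
  named fact `perronTheorem_sharp` (`PerronSharpDegreeBound`), giving the printed `B = δ^r`;
* `card_le_jacobianRank_of_algebraicIndependent_of_degreeBound` — the rectangular step exactly as
  in the characteristic-`0` file (matroid exchange `exists_isTranscendenceBasis_between` = «we may
  assume `f_1, …, f_r, x_{r+1}, …, x_n` are algebraically independent»; the square Jacobian of that
  basis is a block of rows of `Jac(F)` and unit rows);
* **`ForbesShpilkaVolk2018_fact51_of_perron : perronTheorem_sharp → ForbesShpilkaVolk2018_fact51 F`**
  for EVERY field `F` (both clauses), and the unconditional large-characteristic variant
  `jacobianRank_eq_of_trdeg_of_perronBound_lt_ringChar`.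

Honest framing: Fact 51 is thereby a THEOREM in characteristic `0` and PROVED MODULO the sharp
Perron degree bound in characteristic `p > δ^r`; unconditionally it is proved for
`p > (N+1)(2δ'(N+1))^N` (`δ' = max δ 1`, `N` variables).  Nothing here bears on `VP ≠ VNP`.

## References
* [BeeckenMittmannSaxena2013] Thm. 4 (Perron), Thm. 6 + App. A (arXiv:1102.2789 pp. 5, 14).
* [ForbesShpilkaVolk2018] Fact 51 (seq.) = arXiv v2 / ToC Fact 6.2.
* [Humphreys1990] § 3.10 (the square criterion; tree `Literature.Algebra.Polynomial.JacobianCriterion`).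
* [Ploski2005] Thm. 1.1; [Perron1927] Satz 57.
-/

noncomputable section

open MvPolynomial Finset Matrix
open scoped BigOperators Matrix

namespace Literature.Computability.AlgebraicComplexity

open Literature.Algebra.Polynomial.JacobianCriterion Literature.RingTheory.Nullstellensatz

universe u v

section SquarePosChar

variable {K : Type u} [Field K] {σ : Type v}

/-- Characteristic-free form of «`∂p/∂xᵢ = 0 ⟹ xᵢ` does not occur in `p`»: if `∂p/∂xᵢ = 0` and
every exponent `e` with `1 ≤ e ≤ deg p` is non-zero in `K` (e.g. `char K = 0` or `char K > deg p`),
then `xᵢ ∉ vars p`. [cite: BeeckenMittmannSaxena2013, App. A, proof of Thm. 6 ("by the assumptions on ch(K), we have ∂_{y₀}F_i ≠ 0")]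
locator: paper:arxiv-1102.2789 p0014.txt:L66–L68 -/
theorem notMem_vars_of_pderiv_eq_zero_of_cast_ne_zero {i : σ} {p : MvPolynomial σ K}
    (hp : pderiv i p = 0) (hdeg : ∀ e : ℕ, 1 ≤ e → e ≤ p.totalDegree → (e : K) ≠ 0) :
    i ∉ p.vars := by
  classical
  intro hi
  obtain ⟨s, hs, his⟩ := (mem_vars_iff_mem_support i).mp hi
  have hsi : s i ≠ 0 := Finsupp.mem_support_iff.mp his
  have e : s = (s - Finsupp.single i 1) + Finsupp.single i 1 := by
    ext j
    simp only [Finsupp.coe_add, Finsupp.coe_tsub, Pi.add_apply, Pi.sub_apply, Finsupp.single_apply]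
    split_ifs with h
    · subst h; omega
    · omega
  have h := coeff_pderiv (i := i) p (s - Finsupp.single i 1)
  rw [hp, coeff_zero, ← e] at h
  rcases mul_eq_zero.mp h.symm with h' | h'
  · exact (mem_support_iff.mp hs) h'
  · -- the exponent `s i` is non-zero in `K`
    refine hdeg (s i) (Nat.one_le_iff_ne_zero.mpr hsi) ?_ ?_
    · exact le_trans (Finset.single_le_sum (fun _ _ => Nat.zero_le _) his) (le_totalDegree hs)
    · have hcast : ((s i : ℕ) : K) = (((s - Finsupp.single i 1 : σ →₀ ℕ) i : ℕ) : K) + 1 := by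
        have : s i = (s - Finsupp.single i 1 : σ →₀ ℕ) i + 1 := by
          simp only [Finsupp.coe_tsub, Pi.sub_apply, Finsupp.single_eq_same]; omega
        rw [this, Nat.cast_add, Nat.cast_one]
      rw [hcast]
      exact h'

variable {ι : Type v} [Fintype ι] [DecidableEq ι]

/-- **The Jacobian criterion, square case, «⟹» in ANY characteristic under a degree bound on the
relations** (the argument of Humphreys § 3.10 / [BMS13] App. A): let `f₁, …, fₙ ∈ K[x₁, …, xₙ]` be
algebraically independent and suppose that for each `i` the (necessarily dependent) family
`xᵢ, f₁, …, fₙ` has a non-zero relation of total degree `≤ B`, where every `1 ≤ e ≤ B` is non-zero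
in `K`. Then `J(f₁, …, fₙ) ≠ 0`. Proof as printed: a relation `Hᵢ` of least degree has
`deg Hᵢ ≤ B`, involves `y₀` (independence of the `fⱼ`), so `∂Hᵢ/∂y₀ ≠ 0` (exponents `≤ B`), and
`(∂Hᵢ/∂y₀)(xᵢ, f) ≠ 0` by minimality; the chain rule gives `N · J = −diag(wᵢ)` with `wᵢ ≠ 0`.
[cite: BeeckenMittmannSaxena2013, App. A (proof of Thm. 6); Humphreys1990, § 3.10 Proposition (⇒)]
locator: paper:arxiv-1102.2789 p0014.txt:L53–L100 -/
theorem det_jacobianMatrix_ne_zero_of_algebraicIndependent_of_degreeBound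
    (f : ι → MvPolynomial ι K) (hf : AlgebraicIndependent K f) (B : ℕ)
    (hrel : ∀ i, ∃ H : MvPolynomial (Option ι) K, H ≠ 0 ∧
      aeval (fun o : Option ι => o.elim (X i) f) H = 0 ∧ H.totalDegree ≤ B)
    (hB : ∀ e : ℕ, 1 ≤ e → e ≤ B → (e : K) ≠ 0) :
    (jacobianMatrix f).det ≠ 0 := by
  classical
  -- for each `i`: a relation `H` of least degree between `xᵢ, f₁, …, fₙ`, with `(∂H/∂y₀)(xᵢ, f) ≠ 0`
  have key : ∀ i, ∃ H : MvPolynomial (Option ι) K,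
      aeval (fun o : Option ι => o.elim (X i) f) H = 0 ∧
        aeval (fun o : Option ι => o.elim (X i) f) (pderiv none H) ≠ 0 := by
    intro i
    set g : Option ι → MvPolynomial ι K := fun o => o.elim (X i) f with hg
    have hex : ∃ m, ∃ H : MvPolynomial (Option ι) K, H ≠ 0 ∧ aeval g H = 0 ∧ H.totalDegree = m := by
      obtain ⟨H, hne, h0, -⟩ := hrel i
      exact ⟨_, H, hne, h0, rfl⟩
    obtain ⟨H, hne, h0, hm⟩ := Nat.find_spec hex
    -- the least degree is `≤ B`
    have hmB : Nat.find hex ≤ B := by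
      obtain ⟨H', hne', h0', hB'⟩ := hrel i
      exact (Nat.find_min' hex ⟨H', hne', h0', rfl⟩).trans hB'
    refine ⟨H, h0, fun hw => ?_⟩
    -- `∂H/∂y₀ ≠ 0`: otherwise `H` is a relation among the `fⱼ` alone
    have hd : pderiv none H ≠ 0 := by
      intro hd
      have hvars : (↑H.vars : Set (Option ι)) ⊆ Set.range (some : ι → Option ι) := by
        intro o ho
        cases o with
        | none =>
          refine absurd ho (notMem_vars_of_pderiv_eq_zero_of_cast_ne_zero hd fun e h1 h2 => ?_)
          exact hB e h1 (h2.trans (hm.le.trans hmB))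
        | some j => exact ⟨j, rfl⟩
      obtain ⟨H', rfl⟩ := exists_rename_eq_of_vars_subset_range H some (Option.some_injective ι) hvars
      rw [aeval_rename] at h0
      have hgf : g ∘ some = f := funext fun j => rfl
      rw [hgf] at h0
      have hH' : H' = 0 := algebraicIndependent_iff.mp hf H' h0
      exact hne (by rw [hH', map_zero])
    exact Nat.find_min hex (hm ▸ totalDegree_pderiv_lt hd) ⟨_, hd, hw, rfl⟩
  choose H hH0 hw using key
  -- the matrix identity (27): `N * (∂fⱼ/∂x_k) = −diag(wᵢ)`
  set N : Matrix ι ι (MvPolynomial ι K) :=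
    Matrix.of fun i j => aeval (fun o : Option ι => o.elim (X i) f) (pderiv (some j) (H i)) with hN
  set w : ι → MvPolynomial ι K :=
    fun i => aeval (fun o : Option ι => o.elim (X i) f) (pderiv none (H i)) with hw'
  have h27 : N * jacobianMatrix f = -Matrix.diagonal w := by
    refine Matrix.ext fun i k => ?_
    have hc := pderiv_aeval (fun o : Option ι => o.elim (X i) f) (H i) k
    rw [hH0 i, map_zero, Fintype.sum_option] at hc
    simp only [Option.elim_none, Option.elim_some, pderiv_X] at hc
    rw [Matrix.mul_apply, Matrix.neg_apply, Matrix.diagonal_apply]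
    simp only [hN, Matrix.of_apply, jacobianMatrix_apply]
    rw [eq_neg_iff_add_eq_zero, add_comm]
    have e : (if i = k then w i else 0) =
        aeval (fun o : Option ι => o.elim (X i) f) (pderiv none (H i)) *
          (Pi.single k 1 : ι → MvPolynomial ι K) i := by
      rw [Pi.single_apply, mul_ite, mul_one, mul_zero]
    rw [e]
    exact hc.symm
  -- determinants
  intro hJ
  have hdet := congrArg Matrix.det h27
  rw [Matrix.det_mul, hJ, mul_zero, Matrix.det_neg, Matrix.det_diagonal] at hdet
  refine (mul_ne_zero (pow_ne_zero _ (neg_ne_zero.mpr one_ne_zero))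
    (Finset.prod_ne_zero_iff.mpr fun i _ => hw i)) hdet.symm

end SquarePosChar


/-! ### Relations of bounded degree for `xᵢ, f₁, …, fₙ` (Perron, weak and sharp) -/

section Relations

variable {K : Type u} [Field K] {ι : Type v} [Fintype ι]

/-- **Weak Perron, `Option`-indexed:** a family `Q : Option ι → K[ι]` (one more polynomial than
variables) of total degrees `≤ δ`, `δ ≥ 1`, has a non-zero relation of total degree
`≤ perronBound |ι| δ = (|ι|+1)(2δ(|ι|+1))^{|ι|}` — the tree's PROVED weak Perron theorem
transported along `ι ≃ Fin n`, `Option ι ≃ Fin (n+1)`. [cite: Ploski2005, Thm. 1.1 (weak form; tree `exists_algRelation_of_totalDegree_le`)] -/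
theorem exists_relation_option_of_totalDegree_le (Q : Option ι → MvPolynomial ι K) {δ : ℕ}
    (hδ : 1 ≤ δ) (hQ : ∀ o, (Q o).totalDegree ≤ δ) :
    ∃ F : MvPolynomial (Option ι) K, F ≠ 0 ∧ aeval Q F = 0 ∧
      F.totalDegree ≤ perronBound (Fintype.card ι) δ := by
  classical
  set n := Fintype.card ι with hn
  let eι : ι ≃ Fin n := Fintype.equivFin ι
  let eo : Option ι ≃ Fin (n + 1) := (Equiv.optionCongr eι).trans (finSuccEquiv n).symm
  let g : Fin (n + 1) → MvPolynomial (Fin n) K := fun k => rename eι (Q (eo.symm k))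
  have hg : ∀ k, (g k).totalDegree ≤ δ := fun k => by
    simp only [g, ← renameEquiv_apply, totalDegree_renameEquiv]
    exact hQ _
  obtain ⟨G, hG0, hG, -, hGdeg⟩ := exists_algRelation_of_totalDegree_le g hδ hg
  refine ⟨rename eo.symm G, ?_, ?_, ?_⟩
  · exact fun h0 => hG0 (rename_injective _ eo.symm.injective (by rw [h0, map_zero]))
  · have hcomp : Q ∘ eo.symm = fun k => rename eι.symm (g k) := by
      funext k
      simp only [Function.comp_apply, g, rename_rename, Equiv.symm_comp_self, rename_id_apply]
    rw [aeval_rename, hcomp, ← comp_aeval, AlgHom.comp_apply, hG, map_zero]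
  · rwa [← renameEquiv_apply, totalDegree_renameEquiv]

end Relations

section RelationsSharp

variable {K : Type} [Field K] {ι : Type} [Fintype ι]

/-- The sharp bound with `m = 1`: a non-zero relation of total degree `≤ ∏ deg f_i` among `n + 1`
non-constant polynomials in `n` variables. [cite: BeeckenMittmannSaxena2013, Thm. 4 (with min δᵢ ≥ 1)] -/
theorem exists_relation_totalDegree_le_prod_of_perron (h : perronTheorem_sharp)
    {n : ℕ} (f : Fin (n + 1) → MvPolynomial (Fin n) K)
    (hf : ∀ i, 1 ≤ (f i).totalDegree) :
    ∃ F : MvPolynomial (Fin (n + 1)) K, F ≠ 0 ∧ aeval f F = 0 ∧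
      F.totalDegree ≤ ∏ i, (f i).totalDegree := by
  obtain ⟨F, hF0, hF, hdeg⟩ := h K n f 1 le_rfl hf
  exact ⟨F, hF0, hF, by simpa using hdeg⟩

/-- The sharp bound for a family indexed by `Option ι` over the variables `ι` (a distinguished
polynomial `f none` and one polynomial `f (some j)` per variable), `ι` finite: a non-zero relation
of total degree `≤ ∏ deg f_o` — the shape used by the Jacobian criterion («by Theorem 4 (with
`(n−r+1)` of the `δ_i`'s being `1`)», [BMS13] App. A). Reindexing along `Fin (n+1) ≃ Option (Fin n)`
and `ι ≃ Fin n`. [cite: BeeckenMittmannSaxena2013, Thm. 4 and App. A (proof of Thm. 6)]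
locator: paper:arxiv-1102.2789 p0014.txt:L63–L65 -/
theorem exists_relation_option_of_perron (h : perronTheorem_sharp)
    (f : Option ι → MvPolynomial ι K)
    (hf : ∀ o, 1 ≤ (f o).totalDegree) :
    ∃ F : MvPolynomial (Option ι) K, F ≠ 0 ∧ aeval f F = 0 ∧
      F.totalDegree ≤ ∏ o, (f o).totalDegree := by
  classical
  -- transport to `Fin (n+1)` polynomials in `Fin n` variables
  set n := Fintype.card ι with hn
  let eι : ι ≃ Fin n := Fintype.equivFin ι
  let eo : Option ι ≃ Fin (n + 1) := (Equiv.optionCongr eι).trans (finSuccEquiv n).symm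
  let g : Fin (n + 1) → MvPolynomial (Fin n) K := fun k => rename eι (f (eo.symm k))
  have hg : ∀ k, (g k).totalDegree = (f (eo.symm k)).totalDegree := fun k => by
    simp only [g, ← renameEquiv_apply, totalDegree_renameEquiv]
  have hg1 : ∀ k, 1 ≤ (g k).totalDegree := fun k => (hg k).symm ▸ hf _
  obtain ⟨G, hG0, hG, hGdeg⟩ := exists_relation_totalDegree_le_prod_of_perron h g hg1
  -- pull the relation back along `eo`
  refine ⟨rename eo.symm G, ?_, ?_, ?_⟩
  · exact fun h0 => hG0 (rename_injective _ eo.symm.injective (by rw [h0, map_zero]))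
  · -- `aeval f (rename eo.symm G) = rename eι.symm (aeval g G) = 0`
    have hcomp : f ∘ eo.symm = fun k => rename eι.symm (g k) := by
      funext k
      simp only [Function.comp_apply, g, rename_rename, Equiv.symm_comp_self, rename_id_apply]
    rw [aeval_rename, hcomp, ← comp_aeval, AlgHom.comp_apply, hG, map_zero]
  · rw [← renameEquiv_apply, totalDegree_renameEquiv]
    refine hGdeg.trans (le_of_eq ?_)
    rw [← eo.symm.prod_comp (fun o => (f o).totalDegree)]
    exact Finset.prod_congr rfl fun k _ => hg k


end RelationsSharp

/-! ### The rectangular step («we may assume `f_1, …, f_r, x_{r+1}, …, x_n` are algebraically independent») -/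

section Rectangular

variable {F : Type u} [Field F]

/-- **The Jacobian criterion, rectangular form, `≥`-half, under a degree bound on relations:** if
`F_i`, `i ∈ S`, are algebraically independent, and for every algebraically independent square
family `g` drawn from `{F_i}_{i ∈ S} ∪ {X_j}` each `x_i, g` has a non-zero relation of degree `≤ B`
with all `1 ≤ e ≤ B` non-zero in `F`, then `rank_{F(X)} Jac(F) ≥ |S|`. Proof as printed ([BMS13]
App. A; the characteristic-`0` file): extend `{F_i}_{i ∈ S}` by variables to a transcendence basis
(`exists_isTranscendenceBasis_between`; `N` elements), whose square Jacobian is non-singular by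
`det_jacobianMatrix_ne_zero_of_algebraicIndependent_of_degreeBound`, and whose rows are rows of
`Jac(F)` or unit vectors. [cite: BeeckenMittmannSaxena2013, App. A (proof of Thm. 6); ForbesShpilkaVolk2018, Fact 51 (seq.; = ToC Fact 6.2)]
locator: paper:arxiv-1102.2789 p0014.txt:L60–L100 -/
theorem card_le_jacobianRank_of_algebraicIndependent_of_degreeBound {N M : ℕ}
    (Fv : Fin M → MvPolynomial (Fin N) F) (S : Finset (Fin M))
    (hind : AlgebraicIndependent F fun i : S => Fv i) (B : ℕ)
    (hB : ∀ e : ℕ, 1 ≤ e → e ≤ B → (e : F) ≠ 0)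
    (hrel : ∀ g : Fin N → MvPolynomial (Fin N) F, AlgebraicIndependent F g →
      (∀ j, g j ∈ (Set.range fun i : S => Fv i) ∪ Set.range (X : Fin N → MvPolynomial (Fin N) F)) →
      ∀ i, ∃ H : MvPolynomial (Option (Fin N)) F, H ≠ 0 ∧
        aeval (fun o : Option (Fin N) => o.elim (X i) g) H = 0 ∧ H.totalDegree ≤ B) :
    S.card ≤ jacobianRank Fv := by
  classical
  -- notation (`A = 𝔽[X]`, `K = 𝔽(X)`)
  let K := FractionRing (MvPolynomial (Fin N) F)
  let toK := algebraMap (MvPolynomial (Fin N) F) K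
  set J := jacobianMatrix Fv with hJ
  have hrank : jacobianRank Fv = (J.map toK).rank := rfl
  -- the set `s` of the `F_i`, `i ∈ S`, and `t = s ∪ {X_j}`
  set s : Set (MvPolynomial (Fin N) F) := Set.range fun i : S => Fv i with hs
  have hsind : AlgebraicIndepOn F id s := by
    simpa [AlgebraicIndepOn] using hind.to_subtype_range
  set t : Set (MvPolynomial (Fin N) F) := s ∪ Set.range (X : Fin N → MvPolynomial (Fin N) F) with ht
  have htop : Algebra.adjoin F t = ⊤ := by
    refine top_le_iff.mp ?_
    rw [← MvPolynomial.adjoin_range_X]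
    exact Algebra.adjoin_mono Set.subset_union_right
  haveI : Algebra.IsAlgebraic (Algebra.adjoin F t) (MvPolynomial (Fin N) F) := by
    rw [htop]
    haveI := Algebra.isIntegral_of_surjective
      (R := (⊤ : Subalgebra F (MvPolynomial (Fin N) F))) (B := MvPolynomial (Fin N) F)
      (fun a => ⟨⟨a, Algebra.mem_top⟩, rfl⟩)
    infer_instance
  -- a transcendence basis `u` between `s` and `t`
  obtain ⟨u, hsu, hut, hu⟩ := exists_isTranscendenceBasis_between s t Set.subset_union_left hsind
  -- `|u| = N`
  have hcard : Cardinal.mk u = N := by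
    have h := hu.lift_cardinalMk_eq (IsTranscendenceBasis.mvPolynomial (Fin N) F)
    rw [Cardinal.mk_fin, Cardinal.lift_natCast, Cardinal.lift_eq_nat_iff] at h
    exact h
  obtain ⟨e⟩ := Cardinal.mk_eq_nat_iff.mp hcard
  have hufin : u.Finite := Set.finite_coe_iff.mp (Finite.of_equiv _ e.symm)
  have huN : u.ncard = N := by
    rw [← Nat.card_coe_set_eq, Nat.card_congr e, Nat.card_fin]
  -- `|s| = |S|`
  have hsr : s.ncard = S.card := by
    rw [hs, Set.ncard_range_of_injective hind.injective, Nat.card_eq_fintype_card, Fintype.card_coe]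
  -- the square family `g : Fin N → A` enumerating `u`
  let g : Fin N → MvPolynomial (Fin N) F := fun j => (e.symm j : MvPolynomial (Fin N) F)
  have hg : AlgebraicIndependent F g := hu.1.comp _ e.symm.injective
  have hgt : ∀ j, g j ∈ s ∪ Set.range (X : Fin N → MvPolynomial (Fin N) F) := fun j => hut (e.symm j).2
  have hdet : (jacobianMatrix g).det ≠ 0 :=
    det_jacobianMatrix_ne_zero_of_algebraicIndependent_of_degreeBound g hg B (hrel g hg hgt) hB
  -- its Jacobian has rank `N` over `K`
  have hrankg : ((jacobianMatrix g).map toK).rank = N := by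
    have hU : IsUnit ((jacobianMatrix g).map toK) := by
      rw [Matrix.isUnit_iff_isUnit_det, isUnit_iff_ne_zero, ← RingHom.mapMatrix_apply,
        ← RingHom.map_det]
      exact fun h0 => hdet (IsFractionRing.injective (MvPolynomial (Fin N) F) K (by rw [h0, map_zero]))
    rw [Matrix.rank_of_isUnit _ hU, Fintype.card_fin]
  -- the variables in `u` but not in `s`
  set T : Finset (Fin N) :=
    Finset.univ.filter fun k => (X k : MvPolynomial (Fin N) F) ∈ u ∧ (X k : MvPolynomial (Fin N) F) ∉ s
    with hT
  have hTcard : T.card + S.card ≤ N := by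
    have h1 : T.card ≤ (u \ s).ncard := by
      rw [Set.ncard_eq_toFinset_card _ (hufin.subset Set.sdiff_subset)]
      refine Finset.card_le_card_of_injOn (fun k => (X k : MvPolynomial (Fin N) F)) (fun k hk => ?_) ?_
      · rw [Finset.mem_coe] at hk
        simp only [Set.Finite.coe_toFinset]
        exact (Finset.mem_filter.1 hk).2
      · intro k _ k' _ hkk'
        exact X_injective hkk'
    have h2 := Set.ncard_sdiff_add_ncard_of_subset hsu hufin
    omega
  -- every row of `Jac(g)` is a row of `Jac(F)|_S` or a unit vector `e_k`, `k ∈ T`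
  let JS : Matrix S (Fin N) K := (J.map toK).submatrix (fun i : S => (i : Fin M)) id
  let V₁ : Submodule K (Fin N → K) := Submodule.span K (Set.range JS.row)
  let V₂ : Submodule K (Fin N → K) := Submodule.span K (Set.range fun k : T => Pi.single (k : Fin N) (1 : K))
  have hrows : Set.range ((jacobianMatrix g).map toK).row ⊆ (V₁ ⊔ V₂ : Submodule K (Fin N → K)) := by
    rintro _ ⟨j, rfl⟩
    have hju : (e.symm j : MvPolynomial (Fin N) F) ∈ u := (e.symm j).2
    by_cases hjs : (e.symm j : MvPolynomial (Fin N) F) ∈ s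
    · -- a row of `Jac(F)`
      obtain ⟨i, hi⟩ := hjs
      have hgj : g j = Fv i := hi.symm
      have hrow : ((jacobianMatrix g).map toK).row j = JS.row i := by
        funext k
        show toK (pderiv k (g j)) = toK (pderiv k (Fv i))
        rw [hgj]
      rw [hrow]
      exact Submodule.mem_sup_left (Submodule.subset_span ⟨i, rfl⟩)
    · -- a variable: unit row
      have hjt := hut hju
      rcases hjt with hjs' | ⟨k, hk⟩
      · exact absurd hjs' hjs
      have hkT : k ∈ T := Finset.mem_filter.2 ⟨Finset.mem_univ _, hk ▸ hju, hk ▸ hjs⟩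
      have hgj : g j = X k := hk.symm
      have hrow : ((jacobianMatrix g).map toK).row j = Pi.single k 1 := by
        funext k'
        show toK (pderiv k' (g j)) = (Pi.single k (1 : K) : Fin N → K) k'
        rw [hgj, pderiv_X]
        by_cases hkk : k' = k
        · subst hkk
          simp
        · rw [Pi.single_eq_of_ne (Ne.symm hkk), Pi.single_eq_of_ne hkk, map_zero]
      rw [hrow]
      exact Submodule.mem_sup_right (Submodule.subset_span ⟨⟨k, hkT⟩, rfl⟩)
  -- ranks
  have hN : (N : ℕ) ≤ Module.finrank K V₁ + Module.finrank K V₂ := by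
    calc N = ((jacobianMatrix g).map toK).rank := hrankg.symm
      _ = Module.finrank K (Submodule.span K (Set.range ((jacobianMatrix g).map toK).row)) :=
          Matrix.rank_eq_finrank_span_row _
      _ ≤ Module.finrank K (V₁ ⊔ V₂ : Submodule K (Fin N → K)) :=
          Submodule.finrank_mono (Submodule.span_le.2 hrows)
      _ ≤ Module.finrank K V₁ + Module.finrank K V₂ := Submodule.finrank_add_le_finrank_add_finrank _ _
  have hV₁ : Module.finrank K V₁ ≤ jacobianRank Fv := by
    rw [hrank, show Module.finrank K V₁ = JS.rank from (Matrix.rank_eq_finrank_span_row JS).symm]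
    exact Matrix.rank_submatrix_le _ _ _
  have hV₂ : Module.finrank K V₂ ≤ T.card := by
    simpa [Set.finrank] using
      finrank_range_le_card (R := K) fun k : T => (Pi.single (k : Fin N) (1 : K) : Fin N → K)
  omega

end Rectangular

/-! ### Fact 51: the two instantiations -/

section Instances

/-- A member of an algebraically independent family of polynomials is not constant, so has total
degree `≥ 1` (Perron's hypothesis `δ_i ≥ 1`). [cite: BeeckenMittmannSaxena2013, Thm. 4 (hypothesis "of degree δ_i ≥ 1")] -/
theorem one_le_totalDegree_of_algebraicIndependent {F : Type u} [Field F] {σ κ : Type*}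
    {f : κ → MvPolynomial σ F} (hf : AlgebraicIndependent F f) (k : κ) :
    1 ≤ (f k).totalDegree := by
  by_contra h
  have h0 : (f k).totalDegree = 0 := by omega
  rw [totalDegree_eq_zero_iff_eq_C] at h0
  have halg : IsAlgebraic F (f k) := by
    rw [h0, ← MvPolynomial.algebraMap_eq]
    exact isAlgebraic_algebraMap _
  exact hf.transcendental k halg

/-- **`≥`, unconditionally, in characteristic `0` or `> (N+1)(2δ'(N+1))^N`** (`δ' = max δ 1`,
`N` variables): the rectangular step fed with the tree's PROVED weak Perron theorem. A THEOREM
over every field, with a worse characteristic threshold than the printed `δ^r`.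
[cite: BeeckenMittmannSaxena2013, Thm. 6 and App. A (proof), with Thm. 4 replaced by its weak form; Ploski2005, Thm. 1.1 (weak form)] -/
theorem card_le_jacobianRank_of_algebraicIndependent_of_perronBound {F : Type u} [Field F]
    {N M d : ℕ} (Fv : Fin M → MvPolynomial (Fin N) F) (hdeg : ∀ i, (Fv i).totalDegree ≤ d)
    (S : Finset (Fin M)) (hind : AlgebraicIndependent F fun i : S => Fv i)
    (hchar : ∀ e : ℕ, 1 ≤ e → e ≤ perronBound N (max d 1) → (e : F) ≠ 0) :
    S.card ≤ jacobianRank Fv := by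
  classical
  refine card_le_jacobianRank_of_algebraicIndependent_of_degreeBound Fv S hind _ hchar ?_
  intro g _ hgt i
  have hQ : ∀ o : Option (Fin N), (o.elim (X i) g : MvPolynomial (Fin N) F).totalDegree ≤ max d 1 := by
    rintro (_ | j)
    · simp only [Option.elim_none, totalDegree_X]
      exact le_max_right _ _
    · simp only [Option.elim_some]
      rcases hgt j with ⟨k, hk⟩ | ⟨k, hk⟩
      · rw [← hk]; exact (hdeg _).trans (le_max_left _ _)
      · rw [← hk, totalDegree_X]; exact le_max_right _ _
  obtain ⟨H, hH0, hH, hHdeg⟩ :=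
    exists_relation_option_of_totalDegree_le (fun o : Option (Fin N) => o.elim (X i) g)
      (le_max_right d 1) hQ
  rw [Fintype.card_fin] at hHdeg
  exact ⟨H, hH0, hH, hHdeg⟩

/-- **`≥` in characteristic `0` or `> δ^r`, modulo the sharp Perron theorem** — the printed
threshold: the rectangular step fed with `perronTheorem_sharp` («by Theorem 4 (with `(n−r+1)` of
the `δ_i`'s being `1`), we have `deg(F_i) ≤ δ^r`»).
[cite: BeeckenMittmannSaxena2013, Thm. 6 and App. A (proof); ForbesShpilkaVolk2018, Fact 51 (seq.; = ToC Fact 6.2)]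
locator: paper:arxiv-1102.2789 p0014.txt:L63–L65 -/
theorem card_le_jacobianRank_of_algebraicIndependent_of_perron (hP : perronTheorem_sharp)
    {F : Type} [Field F] {N M d : ℕ} (Fv : Fin M → MvPolynomial (Fin N) F)
    (hdeg : ∀ i, (Fv i).totalDegree ≤ d) (S : Finset (Fin M))
    (hind : AlgebraicIndependent F fun i : S => Fv i)
    (hchar : ∀ e : ℕ, 1 ≤ e → e ≤ d ^ S.card → (e : F) ≠ 0) :
    S.card ≤ jacobianRank Fv := by
  classical
  -- `d = 0`: all `F_i` are constants, so `S = ∅`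
  rcases Nat.eq_zero_or_pos d with rfl | hd
  · rcases S.eq_empty_or_nonempty with rfl | ⟨i, hi⟩
    · simp
    · exfalso
      have h1 := one_le_totalDegree_of_algebraicIndependent hind ⟨i, hi⟩
      have h0 := hdeg i
      simp only at h1
      omega
  refine card_le_jacobianRank_of_algebraicIndependent_of_degreeBound Fv S hind _ hchar ?_
  intro g hg hgt i
  -- every member of `xᵢ, g` is non-constant
  have h1 : ∀ o : Option (Fin N), 1 ≤ (o.elim (X i) g : MvPolynomial (Fin N) F).totalDegree := by
    rintro (_ | j)
    · simp only [Option.elim_none, totalDegree_X]; exact le_rfl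
    · simpa only [Option.elim_some] using one_le_totalDegree_of_algebraicIndependent hg j
  obtain ⟨H, hH0, hH, hHdeg⟩ :=
    exists_relation_option_of_perron hP (fun o : Option (Fin N) => o.elim (X i) g) h1
  refine ⟨H, hH0, hH, hHdeg.trans ?_⟩
  -- `∏ deg = ∏_j deg g_j ≤ d ^ #{j : g_j ∈ s} ≤ d ^ |S|`
  rw [Fintype.prod_option]
  simp only [Option.elim_none, Option.elim_some, totalDegree_X, one_mul]
  set s : Set (MvPolynomial (Fin N) F) := Set.range fun i : S => Fv i with hs
  set T : Finset (Fin N) := Finset.univ.filter fun j => g j ∈ s with hT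
  have hprod : ∏ j, (g j).totalDegree ≤ d ^ T.card := by
    rw [← Finset.prod_filter_mul_prod_filter_not Finset.univ (fun j => g j ∈ s)]
    have h1 : ∏ j ∈ Finset.univ.filter (fun j => g j ∈ s), (g j).totalDegree ≤ d ^ T.card := by
      rw [← hT, ← Finset.prod_const]
      refine Finset.prod_le_prod (fun _ _ => Nat.zero_le _) fun j hj => ?_
      obtain ⟨k, hk⟩ : g j ∈ s := (Finset.mem_filter.1 hj).2
      rw [← hk]
      exact hdeg _
    have h2 : ∏ j ∈ Finset.univ.filter (fun j => ¬ g j ∈ s), (g j).totalDegree = 1 := by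
      refine Finset.prod_eq_one fun j hj => ?_
      have hjs : g j ∉ s := (Finset.mem_filter.1 hj).2
      rcases hgt j with h | ⟨k, hk⟩
      · exact absurd h hjs
      · rw [← hk, totalDegree_X]
    rw [h2, mul_one]
    exact h1
  have hTS : T.card ≤ S.card := by
    have hinj : Function.Injective g := hg.injective
    rw [← Finset.card_image_of_injective T hinj]
    calc (T.image g).card ≤ (Finset.univ.image fun i : S => Fv i).card := by
          refine Finset.card_le_card fun p hp => ?_
          obtain ⟨j, hj, rfl⟩ := Finset.mem_image.1 hp
          obtain ⟨i, hi⟩ : g j ∈ s := (Finset.mem_filter.1 hj).2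
          exact Finset.mem_image.2 ⟨i, Finset.mem_univ _, hi⟩
      _ ≤ (Finset.univ : Finset S).card := Finset.card_image_le
      _ = S.card := by rw [Finset.card_univ, Fintype.card_coe]
  exact hprod.trans (Nat.pow_le_pow_right hd hTS)

end Instances

/-! ### FSV Fact 51 over every field (modulo sharp Perron) and the unconditional large-characteristic form -/

section Fact51

/-- The characteristic clause `char F = 0 ∨ char F > B` makes every `1 ≤ e ≤ B` non-zero in `F`.
[cite: BeeckenMittmannSaxena2013, Thm. 6 (hypothesis "ch(K) = 0 or ch(K) > δ^r")] -/
theorem natCast_ne_zero_of_ringChar {F : Type u} [Field F] {B : ℕ}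
    (h : ringChar F = 0 ∨ B < ringChar F) {e : ℕ} (h1 : 1 ≤ e) (h2 : e ≤ B) : (e : F) ≠ 0 := by
  intro he
  rw [ringChar.spec] at he
  rcases h with h0 | hlt
  · rw [h0, zero_dvd_iff] at he
    omega
  · have := Nat.le_of_dvd (by omega) he
    omega

/-- **FSV Fact 51 = [BMS13] Thm. 6 (the Jacobian criterion), BOTH clauses, over EVERY field —
PROVED MODULO the sharp Perron theorem** (`perronTheorem_sharp`, [BMS13 Thm. 4 = Płoski 2005
Thm. 1.1]): for `F_1, …, F_m ∈ 𝔽[X_1, …, X_N]` of degree `≤ d` with `trdeg{F} = r` and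
`char 𝔽 = 0 ∨ char 𝔽 > d^r`, `rank_{𝔽(X)} Jac_X(F) = r`. `≤` is `jacobianRank_le_of_trdegLE`
(any characteristic); `≥` is `card_le_jacobianRank_of_algebraicIndependent_of_perron`. (The
characteristic-`0` clause alone is unconditional: `ForbesShpilkaVolk2018_fact51_of_charZero`.)
[cite: ForbesShpilkaVolk2018, Fact 51 (seq.; = arXiv v2 / ToC Fact 6.2); BeeckenMittmannSaxena2013, Thm. 6 + App. A]
locator: paper:arxiv-1701.05328 p0022.txt:L15; paper:arxiv-1102.2789 p0005.txt:L83–L86, p0014.txt:L53–L100 -/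
theorem ForbesShpilkaVolk2018_fact51_of_perron (hP : perronTheorem_sharp) {F : Type} [Field F] :
    ForbesShpilkaVolk2018_fact51 F := by
  intro N m d r Fv hdeg htr hS hchar
  obtain ⟨S, hSr, hind⟩ := hS
  refine le_antisymm (jacobianRank_le_of_trdegLE htr) ?_
  rw [← hSr]
  refine card_le_jacobianRank_of_algebraicIndependent_of_perron hP Fv hdeg S hind ?_
  rw [hSr]
  exact fun e h1 h2 => natCast_ne_zero_of_ringChar hchar h1 h2

/-- **The Jacobian criterion in characteristic `0` or `> (N+1)(2δ'(N+1))^N`, PROVED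
unconditionally** (`δ' = max δ 1`, `N` = number of variables): `trdeg{F} = r ⟹
rank_{𝔽(X)} Jac_X(F) = r`. This is [BMS13] Thm. 6 with the weak Perron bound of the tree in place
of `δ^r` — an honest theorem over every field, weaker than print in its characteristic threshold.
[cite: BeeckenMittmannSaxena2013, Thm. 6 and App. A (proof), with Thm. 4 in its weak (proved) form; Ploski2005, Thm. 1.1 (weak form)] -/
theorem jacobianRank_eq_of_trdeg_of_perronBound_lt_ringChar {F : Type u} [Field F] {N m d r : ℕ}
    (Fv : Fin m → MvPolynomial (Fin N) F) (hdeg : ∀ i, (Fv i).totalDegree ≤ d)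
    (htr : TrdegLE F Fv r) (hS : ∃ S : Finset (Fin m), S.card = r ∧ AlgebraicIndependent F fun i : S => Fv i)
    (hchar : ringChar F = 0 ∨ perronBound N (max d 1) < ringChar F) : jacobianRank Fv = r := by
  obtain ⟨S, hSr, hind⟩ := hS
  refine le_antisymm (jacobianRank_le_of_trdegLE htr) ?_
  rw [← hSr]
  exact card_le_jacobianRank_of_algebraicIndependent_of_perronBound Fv hdeg S hind
    fun e h1 h2 => natCast_ne_zero_of_ringChar hchar h1 h2

end Fact51

end Literature.Computability.AlgebraicComplexity

end
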